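import Literature.NumberTheory.LFunctions.KloostermanFractionsOffDiagWeil
import Literature.NumberTheory.LFunctions.KloostermanFractionsOffDiagCount
import Literature.NumberTheory.LFunctions.KloostermanFractionsOffDiagCS
import Literature.NumberTheory.LFunctions.KloostermanFractionsAmplifiedForm
import HarnessLib

/-!
# Bilinear forms with Kloosterman fractions: the bound for the dispersion sum `𝒯`

Bettin–Chandee, *Trilinear forms with Kloosterman fractions* (arXiv:1502.00769), §4.1.2–4.1.3,
in the simplified setting of this series (`A = 1`, prime `ℓ₂` outside Cauchy–Schwarz).
We bound the sum `𝒯` produced by `kfs_S_norm_le`: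

  `𝒯 = Σ_{ℓ₂} Σ_{n₁,n₂ ∈ supp γ} Σ_{c} |Σ_{ℓ₁} [NDC] Σ_{0<|d|≤D} [A] E|²`.

Opening the square (`kfc_expand_sq_le`), a diagonal pair `(ℓ₁,d) = (ℓ₁',d')` is counted
trivially (`kfc_diag_count`), and an off-diagonal pair is bounded by Weil's bound
(`kfw_pair_sum_le`) on at most `(d-d',b)` admissible classes `c` (`kfc_csum_le`), summed over
`n₁` (`kfc_rhs_sum_le`) and over the pairs (`kfc_pair_weight_le`).

Main result: `kft_T_le`.

## References
* S. Bettin, V. Chandee, *Trilinear forms with Kloosterman fractions*, Adv. Math. 328 (2018),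
  arXiv:1502.00769, §4.1.2–4.1.3. [cite: BettinChandee2018, §4.1.3]
* W. Duke, J. Friedlander, H. Iwaniec, *Bilinear forms with Kloosterman fractions*,
  Invent. Math. 128 (1997) 23–43, §4. [cite: DukeFriedlanderIwaniec1997, §4]
-/

noncomputable section

open Finset

namespace Literature.NumberTheory.LFunctions

/-! ### Small facts about pairs -/

/-- `|e(a v / q)| = 1`. [folklore] -/
theorem kft_norm_e (a : ℤ) (v q : ℕ) :
    ‖Complex.exp (2 * Real.pi * Complex.I * ((a : ℂ) * (v : ℂ) / (q : ℂ)))‖ = 1 := by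
  have h : 2 * (Real.pi : ℂ) * Complex.I * ((a : ℂ) * (v : ℂ) / (q : ℂ)) =
      (((2 * Real.pi * ((a : ℝ) * (v : ℝ) / (q : ℝ))) : ℝ) : ℂ) * Complex.I := by
    push_cast; ring
  rw [h, Complex.norm_exp_ofReal_mul_I]

/-- For a contributing term, `ℓ₁ ∤ d`: otherwise `ℓ₁ ∣ w = ℓ₁n₁ - ℓ₂n₂` gives `ℓ₁ ∣ ℓ₂ n₂`,
contradicting `ℓ₁ ≠ ℓ₂` and `(n₁n₂, ℓ₁ℓ₂) = 1` (B–C: "`(d, ℓ₁n₁) = 1`").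
[cite: BettinChandee2018, §4.1.1] -/
theorem kft_not_dvd {ℓ₁ ℓ₂ n₁ n₂ : ℕ} (hp₁ : ℓ₁.Prime) (hp₂ : ℓ₂.Prime)
    (hNDC : ℓ₁ ≠ ℓ₂ ∧ n₁.Coprime n₂ ∧ (n₁ * n₂).Coprime (ℓ₁ * ℓ₂)) {d : ℤ}
    (hdw : d ∣ ((ℓ₁ * n₁ : ℤ) - ℓ₂ * n₂)) : ¬ ((ℓ₁ : ℤ) ∣ d) := by
  intro h
  have h1 : (ℓ₁ : ℤ) ∣ (ℓ₂ : ℤ) * n₂ := by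
    have h2 : (ℓ₁ : ℤ) ∣ ((ℓ₁ * n₁ : ℤ) - ℓ₂ * n₂) := h.trans hdw
    have h3 : (ℓ₁ : ℤ) ∣ (ℓ₁ : ℤ) * n₁ := dvd_mul_right _ _
    have := Int.dvd_sub h3 h2
    simpa using this
  have h1' : ℓ₁ ∣ ℓ₂ * n₂ := by
    have : ((ℓ₁ : ℕ) : ℤ) ∣ ((ℓ₂ * n₂ : ℕ) : ℤ) := by push_cast; exact h1
    exact Int.natCast_dvd_natCast.mp this
  rcases (Nat.Prime.dvd_mul hp₁).mp h1' with h4 | h4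
  · exact hNDC.1 ((Nat.prime_dvd_prime_iff_eq hp₁ hp₂).mp h4)
  · have h5 : ℓ₁ ∣ Nat.gcd (n₁ * n₂) (ℓ₁ * ℓ₂) :=
      Nat.dvd_gcd (dvd_mul_of_dvd_right h4 _) (dvd_mul_right _ _)
    rw [hNDC.2.2] at h5
    exact hp₁.one_lt.ne' (Nat.dvd_one.mp h5)

/-- **`Δ ≠ 0` off the diagonal** (B–C §4.1.3: "if `Δ = 0`, then … `ℓ₁ = ℓ₁'` … and `d = d'`"):
for primes `ℓ₁, ℓ₁' ≠ ℓ₂`... precisely, if `ℓ₁ ≠ ℓ₂`, `ℓ₁ ∤ d` and `(ℓ₁,d) ≠ (ℓ₁',d')` then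
`Δ' = (dℓ₁' - d'ℓ₁)ℓ₂ - (d-d')ℓ₁ℓ₁' ≠ 0`. [cite: BettinChandee2018, §4.1.3] -/
theorem kft_Delta_ne_zero {ℓ₁ ℓ₁' ℓ₂ : ℕ} (hp₁ : ℓ₁.Prime) (hp₁' : ℓ₁'.Prime) (hp₂ : ℓ₂.Prime)
    (h12 : ℓ₁ ≠ ℓ₂) {d d' : ℤ} (hnd : ¬ ((ℓ₁ : ℤ) ∣ d)) (hpair : (ℓ₁, d) ≠ (ℓ₁', d')) :
    (d * ℓ₁' - d' * ℓ₁) * ℓ₂ - (d - d') * (ℓ₁ * ℓ₁' : ℕ) ≠ 0 := by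
  intro h
  push_cast at h
  by_cases hl : ℓ₁ = ℓ₁'
  · subst hl
    have h1 : (d - d') * (ℓ₁ : ℤ) * ((ℓ₂ : ℤ) - ℓ₁) = 0 := by linear_combination h
    rcases mul_eq_zero.mp h1 with h2 | h2
    · rcases mul_eq_zero.mp h2 with h3 | h3
      · exact hpair (by rw [sub_eq_zero.mp h3])
      · exact hp₁.ne_zero (by exact_mod_cast h3)
    · have : (ℓ₂ : ℤ) = ℓ₁ := sub_eq_zero.mp h2
      exact h12 (by exact_mod_cast this.symm)
  · have hpr : Prime (ℓ₁ : ℤ) := Nat.prime_iff_prime_int.mp hp₁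
    have h1 : (ℓ₁ : ℤ) ∣ d * ℓ₁' * ℓ₂ := by
      have e : d * (ℓ₁' : ℤ) * ℓ₂ = ℓ₁ * (d' * ℓ₂ + (d - d') * ℓ₁') := by linear_combination h
      rw [e]; exact dvd_mul_right _ _
    rcases hpr.dvd_or_dvd h1 with h2 | h2
    · rcases hpr.dvd_or_dvd h2 with h3 | h3
      · exact hnd h3
      · have : ℓ₁ ∣ ℓ₁' := Int.natCast_dvd_natCast.mp h3
        exact hl ((Nat.prime_dvd_prime_iff_eq hp₁ hp₁').mp this)
    · have : ℓ₁ ∣ ℓ₂ := Int.natCast_dvd_natCast.mp h2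
      exact h12 ((Nat.prime_dvd_prime_iff_eq hp₁ hp₂).mp this)

/-- Nonnegativity of the bound of `kfw_pair_sum_le`. [folklore] -/
theorem kft_rhs_nonneg (k : ℤ) (b ℓ₁ ℓ₁' ℓ₂ n₁ : ℕ) (d d' : ℤ) {N' : ℝ} (hN' : 0 ≤ N') :
    0 ≤ 2 * (1 + 2 * Real.pi * |(k : ℝ)| * |((d * ℓ₁' - d' * ℓ₁ : ℤ) : ℝ)| /
          ((b : ℝ) * (ℓ₁ * ℓ₁' * n₁ : ℕ) * ((⌊N'⌋₊ : ℝ) + 1))) *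
        (((⌊2 * N'⌋₊ : ℝ) - ⌊N'⌋₊ + 3) *
            (Int.gcd ((d * ℓ₁' - d' * ℓ₁) * ℓ₂ - (d - d') * (ℓ₁ * ℓ₁' : ℕ)) n₁ : ℝ) / n₁ +
          ((ℓ₁ * ℓ₁' * n₁ : ℕ).divisors.card : ℝ) * Real.sqrt ((ℓ₁ * ℓ₁' * n₁ : ℕ) : ℝ) *
            (if ℓ₁ = ℓ₁' then (ℓ₁ : ℝ) else 1) *
            Real.sqrt (Int.gcd ((d * ℓ₁' - d' * ℓ₁) * ℓ₂ - (d - d') * (ℓ₁ * ℓ₁' : ℕ)) n₁ : ℝ) *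
            (1 + Real.log ((ℓ₁ * ℓ₁' * n₁ : ℕ) : ℝ))) := by
  have h1 : 0 ≤ (⌊2 * N'⌋₊ : ℝ) - ⌊N'⌋₊ + 3 := by
    have : (⌊N'⌋₊ : ℝ) ≤ ⌊2 * N'⌋₊ := by
      exact_mod_cast Nat.floor_le_floor (by linarith : N' ≤ 2 * N')
    linarith
  have h2 : 0 ≤ 1 + Real.log ((ℓ₁ * ℓ₁' * n₁ : ℕ) : ℝ) := by
    have := Real.log_natCast_nonneg (ℓ₁ * ℓ₁' * n₁); linarith
  have h3 : 0 ≤ (if ℓ₁ = ℓ₁' then (ℓ₁ : ℝ) else 1) := by split_ifs <;> positivity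
  refine mul_nonneg (mul_nonneg (by norm_num) ?_) (add_nonneg ?_ ?_)
  · positivity
  · exact div_nonneg (mul_nonneg h1 (Nat.cast_nonneg _)) (Nat.cast_nonneg _)
  · exact mul_nonneg (mul_nonneg (mul_nonneg (mul_nonneg (Nat.cast_nonneg _)
      (Real.sqrt_nonneg _)) h3) (Real.sqrt_nonneg _)) h2

/-! ### The bound for `𝒯` -/

set_option maxHeartbeats 1600000 in
/-- **The dispersion sum `𝒯` of `kfs_S_norm_le`** (B–C §4.1.2–4.1.3 with `A = 1`, `ℓ₂` outside
Cauchy–Schwarz, explicit constants).  Let `b ≥ 1`, `γ` supported on `N' < n ≤ 2N'` with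
`(n, bk) = 1`, `𝓛` a set of primes `L < ℓ ≤ 2L` coprime to `bk` (`L ≥ 1`), `M₁ ≤ M₂`, `D ≥ 0`,
and let `T'` bound `τ(w)` for `1 ≤ w ≤ 16L²(N'+D)`.  Then

  `𝒯 ≤ #𝓛 · ( ⌊2N'⌋ · (#𝓛 · 2D) · ((M₂-M₁)/L + 1)`
  `          + 24 τ(b) L² D² · 4T'N'(1 + 8π|k|D/(bLN'²))((N'+4)/N' + T'L(8N')^{1/2}(1+log(8L²N'))) )`.

The first term is the diagonal `(ℓ₁,d) = (ℓ₁',d')` (B–C's `Δ = 0` terms, counted trivially),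
the second the off-diagonal pairs (Weil's bound, `≤ (d-d',b)` classes `c`, `Σ_{n₁}(Δ,n₁) ≤ 2τN'`).
[cite: BettinChandee2018, §4.1.3] -/
theorem kft_T_le (k : ℤ) {b : ℕ} (hb : 0 < b) (γ : ℕ → ℂ) {N' : ℝ} (hN' : 1 / 2 ≤ N')
    (hγ : ∀ n, γ n ≠ 0 → N' < n ∧ n.Coprime b ∧ Int.gcd k n = 1)
    {L : ℕ} (hL : 1 ≤ L) (𝓛 : Finset ℕ)
    (h𝓛 : ∀ ℓ ∈ 𝓛, ℓ.Prime ∧ L < ℓ ∧ ℓ ≤ 2 * L ∧ ℓ.Coprime b ∧ Int.gcd k ℓ = 1)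
    {M₁ M₂ : ℕ} (hM : M₁ ≤ M₂) (D : ℕ) {T' : ℝ}
    (hT' : ∀ w : ℕ, 1 ≤ w → (w : ℝ) ≤ 16 * (L : ℝ) ^ 2 * (N' + D) → (w.divisors.card : ℝ) ≤ T') :
    ∑ ℓ₂ ∈ 𝓛, ∑ n₁ ∈ (Icc 1 ⌊2 * N'⌋₊).filter (fun n => γ n ≠ 0),
      ∑ n₂ ∈ (Icc 1 ⌊2 * N'⌋₊).filter (fun n => γ n ≠ 0),
      ∑ c ∈ (Finset.range b).filter (fun c => c.Coprime b),
      ‖∑ ℓ₁ ∈ 𝓛, (if (ℓ₁ ≠ ℓ₂ ∧ n₁.Coprime n₂ ∧ (n₁ * n₂).Coprime (ℓ₁ * ℓ₂)) then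
        ∑ d ∈ (Icc (-(D : ℤ)) D).erase 0,
          (if d ∣ ((ℓ₁ * n₁ : ℤ) - ℓ₂ * n₂) ∧ (M₁ : ℤ) < ((ℓ₁ * n₁ : ℤ) - ℓ₂ * n₂) / d ∧
              ((ℓ₁ * n₁ : ℤ) - ℓ₂ * n₂) / d ≤ M₂ ∧
              ((ℓ₁ * n₁ : ℤ) - ℓ₂ * n₂) / d ≡ (c : ℤ) [ZMOD b] then
            Complex.exp (2 * Real.pi * Complex.I *
                (((-(k * d) : ℤ) : ℂ) *
                  (((((b * (ℓ₂ * n₂ : ℤ) : ℤ) : ZMod n₁)⁻¹).val : ℕ) : ℂ) / (n₁ : ℂ))) *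
              (starRingEnd ℂ) (Complex.exp (2 * Real.pi * Complex.I *
                (((-(k * d) : ℤ) : ℂ) *
                  (((((b * (-(ℓ₁ * n₁ : ℤ)) : ℤ) : ZMod n₂)⁻¹).val : ℕ) : ℂ) / (n₂ : ℂ))))
          else 0)
        else 0)‖ ^ 2 ≤
      (𝓛.card : ℝ) * ((⌊2 * N'⌋₊ : ℝ) * ((𝓛.card : ℝ) * (2 * D)) * (((M₂ : ℝ) - M₁) / L + 1) +
        24 * (b.divisors.card : ℝ) * (L : ℝ) ^ 2 * (D : ℝ) ^ 2 *
          (4 * T' * N' * (1 + 8 * Real.pi * |(k : ℝ)| * D / ((b : ℝ) * L * N' ^ 2)) *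
            ((N' + 4) / N' + T' * L * Real.sqrt (8 * N') *
              (1 + Real.log (8 * (L : ℝ) ^ 2 * N'))))) := by
  classical
  -- abbreviations
  set I := Icc 1 ⌊2 * N'⌋₊ with hI
  set I' := I.filter (fun n => γ n ≠ 0) with hI'
  set Cb := (Finset.range b).filter (fun c => c.Coprime b) with hCb
  set Dset := (Icc (-(D : ℤ)) D).erase 0 with hDset
  set T₂ := (Ioc ⌊N'⌋₊ ⌊2 * N'⌋₊).filter (fun n => n.Coprime b) with hT₂
  set NDC : ℕ → ℕ → ℕ → ℕ → Prop := fun ℓ₂ n₁ ℓ₁ n₂ =>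
    ℓ₁ ≠ ℓ₂ ∧ n₁.Coprime n₂ ∧ (n₁ * n₂).Coprime (ℓ₁ * ℓ₂) with hNDC
  set A : ℕ → ℕ → ℕ → ℤ → ℕ → ℕ → Prop := fun ℓ₂ n₁ ℓ₁ d c n₂ =>
    d ∣ ((ℓ₁ * n₁ : ℤ) - ℓ₂ * n₂) ∧ (M₁ : ℤ) < ((ℓ₁ * n₁ : ℤ) - ℓ₂ * n₂) / d ∧
      ((ℓ₁ * n₁ : ℤ) - ℓ₂ * n₂) / d ≤ M₂ ∧ ((ℓ₁ * n₁ : ℤ) - ℓ₂ * n₂) / d ≡ (c : ℤ) [ZMOD b]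
    with hA
  set E : ℕ → ℕ → ℕ → ℤ → ℕ → ℂ := fun ℓ₂ n₁ ℓ₁ d n₂ =>
    Complex.exp (2 * Real.pi * Complex.I *
        (((-(k * d) : ℤ) : ℂ) *
          (((((b * (ℓ₂ * n₂ : ℤ) : ℤ) : ZMod n₁)⁻¹).val : ℕ) : ℂ) / (n₁ : ℂ))) *
      (starRingEnd ℂ) (Complex.exp (2 * Real.pi * Complex.I *
        (((-(k * d) : ℤ) : ℂ) *
          (((((b * (-(ℓ₁ * n₁ : ℤ)) : ℤ) : ZMod n₂)⁻¹).val : ℕ) : ℂ) / (n₂ : ℂ)))) with hE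
  set V : ℕ → ℕ → ℕ → ℕ → ℂ := fun ℓ₂ n₁ n₂ c =>
    ∑ ℓ₁ ∈ 𝓛, (if NDC ℓ₂ n₁ ℓ₁ n₂ then
      ∑ d ∈ Dset, (if A ℓ₂ n₁ ℓ₁ d c n₂ then E ℓ₂ n₁ ℓ₁ d n₂ else 0) else 0) with hV
  set PT : ℕ → ℕ → ℕ → ℤ → ℕ → ℤ → ℕ → ℕ → ℂ := fun ℓ₂ n₁ ℓ₁ d ℓ₁' d' c n₂ =>
    (if (NDC ℓ₂ n₁ ℓ₁ n₂ ∧ NDC ℓ₂ n₁ ℓ₁' n₂) then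
      (if (A ℓ₂ n₁ ℓ₁ d c n₂ ∧ A ℓ₂ n₁ ℓ₁' d' c n₂) then
        E ℓ₂ n₁ ℓ₁ d n₂ * (starRingEnd ℂ) (E ℓ₂ n₁ ℓ₁' d' n₂) else 0) else 0) with hPT
  set RHS : ℕ → ℕ → ℕ → ℤ → ℕ → ℤ → ℝ := fun ℓ₂ n₁ ℓ₁ d ℓ₁' d' =>
    2 * (1 + 2 * Real.pi * |(k : ℝ)| * |((d * ℓ₁' - d' * ℓ₁ : ℤ) : ℝ)| /
          ((b : ℝ) * (ℓ₁ * ℓ₁' * n₁ : ℕ) * ((⌊N'⌋₊ : ℝ) + 1))) *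
        (((⌊2 * N'⌋₊ : ℝ) - ⌊N'⌋₊ + 3) *
            (Int.gcd ((d * ℓ₁' - d' * ℓ₁) * ℓ₂ - (d - d') * (ℓ₁ * ℓ₁' : ℕ)) n₁ : ℝ) / n₁ +
          ((ℓ₁ * ℓ₁' * n₁ : ℕ).divisors.card : ℝ) * Real.sqrt ((ℓ₁ * ℓ₁' * n₁ : ℕ) : ℝ) *
            (if ℓ₁ = ℓ₁' then (ℓ₁ : ℝ) else 1) *
            Real.sqrt (Int.gcd ((d * ℓ₁' - d' * ℓ₁) * ℓ₂ - (d - d') * (ℓ₁ * ℓ₁' : ℕ)) n₁ : ℝ) *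
            (1 + Real.log ((ℓ₁ * ℓ₁' * n₁ : ℕ) : ℝ))) with hRHS
  set F : ℝ := 1 + 8 * Real.pi * |(k : ℝ)| * D / ((b : ℝ) * L * N' ^ 2) with hF
  set C₁ : ℝ := (N' + 4) / N' + T' * L * Real.sqrt (8 * N') *
    (1 + Real.log (8 * (L : ℝ) ^ 2 * N')) with hC₁
  set Bsum : ℝ := 4 * T' * N' * F * C₁ with hBsum
  set Dg : ℝ := ((M₂ : ℝ) - M₁) / L + 1 with hDg
  set W : ℕ → ℤ → ℕ → ℤ → ℝ := fun ℓ₁ d ℓ₁' d' =>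
    (if (ℓ₁, d) = (ℓ₁', d') then (0 : ℝ) else
      (if ((Int.gcd (d - d') b : ℕ) : ℤ) ∣ ((ℓ₁ : ℤ) - ℓ₁') then (Int.gcd (d - d') b : ℝ)
        else 0) * (if ℓ₁ = ℓ₁' then (ℓ₁ : ℝ) else 1)) with hW
  set H : ℕ → ℤ → ℕ → ℤ → ℝ := fun ℓ₁ d ℓ₁' d' =>
    (if (ℓ₁, d) = (ℓ₁', d') then (I'.card : ℝ) * Dg else 0) + W ℓ₁ d ℓ₁' d' * Bsum with hH
  -- basic facts
  have hN'0 : 0 < N' := by linarith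
  have hL0 : (0 : ℝ) < L := by exact_mod_cast hL
  have hL1 : (1 : ℝ) ≤ L := by exact_mod_cast hL
  have hNN : ⌊N'⌋₊ ≤ ⌊2 * N'⌋₊ := Nat.floor_le_floor (by linarith)
  have hT'1 : 1 ≤ T' := by
    have h := hT' 1 le_rfl (by
      push_cast
      have : (1 : ℝ) ≤ (L : ℝ) ^ 2 := by nlinarith
      have : (0 : ℝ) ≤ D := Nat.cast_nonneg _
      nlinarith)
    simpa using h
  have hF0 : 0 ≤ F := by rw [hF]; positivity
  have hlog8 : 0 ≤ Real.log (8 * (L : ℝ) ^ 2 * N') := by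
    refine Real.log_nonneg ?_
    have : (1 : ℝ) ≤ (L : ℝ) ^ 2 := by nlinarith
    nlinarith
  have hC₁0 : 0 ≤ C₁ := by rw [hC₁]; positivity
  have hT'0 : 0 ≤ T' := by linarith
  have hBsum0 : 0 ≤ Bsum :=
    mul_nonneg (mul_nonneg (mul_nonneg (mul_nonneg (by norm_num) hT'0) hN'0.le) hF0) hC₁0
  have hDg0 : 0 ≤ Dg := by
    rw [hDg]
    have : (M₁ : ℝ) ≤ M₂ := by exact_mod_cast hM
    have : 0 ≤ ((M₂ : ℝ) - M₁) / L := div_nonneg (by linarith) hL0.le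
    linarith
  have hW0 : ∀ ℓ₁ d ℓ₁' d', 0 ≤ W ℓ₁ d ℓ₁' d' := by
    intro ℓ₁ d ℓ₁' d'
    simp only [hW]
    split_ifs <;> positivity
  have h𝓛' : ∀ ℓ ∈ 𝓛, L < ℓ ∧ ℓ ≤ 2 * L := fun ℓ hℓ => ⟨(h𝓛 ℓ hℓ).2.1, (h𝓛 ℓ hℓ).2.2.1⟩
  have hI'sub : I' ⊆ Icc 1 ⌊2 * N'⌋₊ := Finset.filter_subset _ _
  have hI'N : ∀ n ∈ I', N' < n := fun n hn => (hγ n (Finset.mem_filter.mp hn).2).1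
  have hI'T₂ : I' ⊆ T₂ := by
    intro n hn
    have hn' := Finset.mem_filter.mp hn
    have hnI := Finset.mem_Icc.mp hn'.1
    obtain ⟨hNn, hnb, _⟩ := hγ n hn'.2
    refine Finset.mem_filter.mpr ⟨Finset.mem_Ioc.mpr ⟨?_, hnI.2⟩, hnb⟩
    exact (Nat.floor_lt hN'0.le).mpr hNn
  have hI'card : (I'.card : ℝ) ≤ ⌊2 * N'⌋₊ := by
    have h1 : I'.card ≤ I.card := Finset.card_filter_le _ _
    rw [hI, Nat.card_Icc] at h1
    have : ⌊2 * N'⌋₊ + 1 - 1 = ⌊2 * N'⌋₊ := by omega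
    rw [this] at h1
    exact_mod_cast h1
  have hDcard : (Dset.card : ℝ) = 2 * D := by
    have h0 : (0 : ℤ) ∈ Icc (-(D : ℤ)) D := by simp
    rw [hDset, Finset.card_erase_of_mem h0, Int.card_Icc]
    have : ((D : ℤ) + 1 - -(D : ℤ)).toNat = 2 * D + 1 := by omega
    rw [this]
    push_cast
    ring
  have hE1 : ∀ ℓ₂ n₁ ℓ₁ d n₂, ‖E ℓ₂ n₁ ℓ₁ d n₂‖ = 1 := by
    intro ℓ₂ n₁ ℓ₁ d n₂
    simp only [hE]
    rw [norm_mul, RCLike.norm_conj, kft_norm_e, kft_norm_e, mul_one]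
  -- Step 1: for fixed `ℓ₂ ∈ 𝓛` and a pair, the `(n₁, c)`-sum is bounded by `H`
  have hpair_bd : ∀ ℓ₂ ∈ 𝓛, ∀ ℓ₁ ∈ 𝓛, ∀ d ∈ Dset, ∀ ℓ₁' ∈ 𝓛, ∀ d' ∈ Dset,
      ∑ n₁ ∈ I', ∑ c ∈ Cb, ‖∑ n₂ ∈ T₂, PT ℓ₂ n₁ ℓ₁ d ℓ₁' d' c n₂‖ ≤ H ℓ₁ d ℓ₁' d' := by
    intro ℓ₂ hℓ₂ ℓ₁ hℓ₁ d hd ℓ₁' hℓ₁' d' hd'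
    obtain ⟨hp₂, hLℓ₂, hℓ₂L, hℓ₂b, _⟩ := h𝓛 ℓ₂ hℓ₂
    obtain ⟨hp₁, hLℓ₁, hℓ₁L, hℓ₁b, hℓ₁k⟩ := h𝓛 ℓ₁ hℓ₁
    obtain ⟨hp₁', hLℓ₁', hℓ₁'L, hℓ₁'b, hℓ₁'k⟩ := h𝓛 ℓ₁' hℓ₁'
    have hd0 : d ≠ 0 := (Finset.mem_erase.mp hd).1
    have hd0' : d' ≠ 0 := (Finset.mem_erase.mp hd').1
    simp only [hH]
    by_cases hpp : (ℓ₁, d) = (ℓ₁', d')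
    · -- diagonal pair
      rw [if_pos hpp]
      obtain ⟨rfl, rfl⟩ := Prod.mk.injEq _ _ _ _ ▸ hpp
      have hWz : W ℓ₁ d ℓ₁ d = 0 := by simp [hW]
      rw [hWz, zero_mul, add_zero]
      have hper : ∀ n₁ ∈ I', ∑ c ∈ Cb, ‖∑ n₂ ∈ T₂, PT ℓ₂ n₁ ℓ₁ d ℓ₁ d c n₂‖ ≤ Dg := by
        intro n₁ _
        have heq : ∀ c, ∑ n₂ ∈ T₂, PT ℓ₂ n₁ ℓ₁ d ℓ₁ d c n₂ =
            ∑ n₂ ∈ T₂, (if NDC ℓ₂ n₁ ℓ₁ n₂ then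
              (if (d ∣ ((ℓ₁ * n₁ : ℤ) - ℓ₂ * n₂) ∧ (M₁ : ℤ) < ((ℓ₁ * n₁ : ℤ) - ℓ₂ * n₂) / d ∧
                  ((ℓ₁ * n₁ : ℤ) - ℓ₂ * n₂) / d ≤ M₂ ∧
                  ((ℓ₁ * n₁ : ℤ) - ℓ₂ * n₂) / d ≡ (c : ℤ) [ZMOD b])
                then E ℓ₂ n₁ ℓ₁ d n₂ * (starRingEnd ℂ) (E ℓ₂ n₁ ℓ₁ d n₂) else 0) else 0) := by
          intro c
          refine Finset.sum_congr rfl fun n₂ _ => ?_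
          simp only [hPT, hA, and_self]
        have hdc := kfc_diag_count b hp₁ hp₂ n₁ d hM T₂ (fun n₂ => NDC ℓ₂ n₁ ℓ₁ n₂)
          (fun n₂ h => ⟨h.1, h.2.2⟩) (fun n₂ => E ℓ₂ n₁ ℓ₁ d n₂ * (starRingEnd ℂ) (E ℓ₂ n₁ ℓ₁ d n₂))
          (fun n₂ => by rw [norm_mul, RCLike.norm_conj, hE1, mul_one])
        calc ∑ c ∈ Cb, ‖∑ n₂ ∈ T₂, PT ℓ₂ n₁ ℓ₁ d ℓ₁ d c n₂‖
            = ∑ c ∈ Cb, ‖∑ n₂ ∈ T₂, (if NDC ℓ₂ n₁ ℓ₁ n₂ then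
              (if (d ∣ ((ℓ₁ * n₁ : ℤ) - ℓ₂ * n₂) ∧ (M₁ : ℤ) < ((ℓ₁ * n₁ : ℤ) - ℓ₂ * n₂) / d ∧
                  ((ℓ₁ * n₁ : ℤ) - ℓ₂ * n₂) / d ≤ M₂ ∧
                  ((ℓ₁ * n₁ : ℤ) - ℓ₂ * n₂) / d ≡ (c : ℤ) [ZMOD b])
                then E ℓ₂ n₁ ℓ₁ d n₂ * (starRingEnd ℂ) (E ℓ₂ n₁ ℓ₁ d n₂) else 0) else 0)‖ := by
              refine Finset.sum_congr rfl fun c _ => ?_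
              rw [heq c]
          _ ≤ ((M₂ : ℝ) - M₁) / ℓ₂ + 1 := hdc
          _ ≤ Dg := by
              rw [hDg]
              have hM' : (0 : ℝ) ≤ (M₂ : ℝ) - M₁ := by
                have : (M₁ : ℝ) ≤ M₂ := by exact_mod_cast hM
                linarith
              have hℓ₂R : (L : ℝ) ≤ ℓ₂ := by exact_mod_cast hLℓ₂.le
              have := div_le_div_of_nonneg_left hM' hL0 hℓ₂R
              linarith
      calc ∑ n₁ ∈ I', ∑ c ∈ Cb, ‖∑ n₂ ∈ T₂, PT ℓ₂ n₁ ℓ₁ d ℓ₁ d c n₂‖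
          ≤ ∑ n₁ ∈ I', Dg := Finset.sum_le_sum hper
        _ = (I'.card : ℝ) * Dg := by rw [Finset.sum_const, nsmul_eq_mul]
    · -- off-diagonal pair
      rw [if_neg hpp, zero_add]
      by_cases hG : ℓ₁ ≠ ℓ₂ ∧ ¬ ((ℓ₁ : ℤ) ∣ d)
      · -- the good case: Weil
        have hΔ := kft_Delta_ne_zero hp₁ hp₁' hp₂ hG.1 hG.2 hpp
        -- per `n₁`
        have hper : ∀ n₁ ∈ I', ∑ c ∈ Cb, ‖∑ n₂ ∈ T₂, PT ℓ₂ n₁ ℓ₁ d ℓ₁' d' c n₂‖ ≤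
            (if ((Int.gcd (d - d') b : ℕ) : ℤ) ∣ ((ℓ₁ : ℤ) - ℓ₁') then (Int.gcd (d - d') b : ℝ)
              else 0) * RHS ℓ₂ n₁ ℓ₁ d ℓ₁' d' := by
          intro n₁ hn₁
          have hn₁' := Finset.mem_filter.mp hn₁
          obtain ⟨_, hn₁b, hn₁k⟩ := hγ n₁ hn₁'.2
          have hn₁pos : 0 < n₁ := (Finset.mem_Icc.mp hn₁'.1).1
          -- Weil for each class
          have hXB : ∀ c, ‖∑ n₂ ∈ T₂, PT ℓ₂ n₁ ℓ₁ d ℓ₁' d' c n₂‖ ≤ RHS ℓ₂ n₁ ℓ₁ d ℓ₁' d' :=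
            fun c => kfw_pair_sum_le k hb hp₁ hp₁' hp₂ hℓ₁b hℓ₁'b hℓ₂b hℓ₁k hℓ₁'k hn₁pos hn₁b
              hn₁k hd0 hd0' c M₁ M₂ ⌊N'⌋₊ ⌊2 * N'⌋₊ hNN
          -- admissibility
          have hX0 : ∀ c, ∑ n₂ ∈ T₂, PT ℓ₂ n₁ ℓ₁ d ℓ₁' d' c n₂ ≠ 0 →
              (c : ℤ) * (d - d') ≡ ((ℓ₁ : ℤ) - ℓ₁') * n₁ [ZMOD b] := by
            intro c hc
            obtain ⟨n₂, _, hn₂⟩ := Finset.exists_ne_zero_of_sum_ne_zero hc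
            simp only [hPT] at hn₂
            by_cases h1 : NDC ℓ₂ n₁ ℓ₁ n₂ ∧ NDC ℓ₂ n₁ ℓ₁' n₂
            · rw [if_pos h1] at hn₂
              by_cases h2 : A ℓ₂ n₁ ℓ₁ d c n₂ ∧ A ℓ₂ n₁ ℓ₁' d' c n₂
              · exact kfc_adm_lincong ⟨h2.1.1, h2.1.2.2.2⟩ ⟨h2.2.1, h2.2.2.2.2⟩
              · rw [if_neg h2] at hn₂; exact absurd rfl hn₂
            · rw [if_neg h1] at hn₂; exact absurd rfl hn₂
          have hcs := kfc_csum_le hb (d - d') (((ℓ₁ : ℤ) - ℓ₁') * n₁)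
            (fun c => ∑ n₂ ∈ T₂, PT ℓ₂ n₁ ℓ₁ d ℓ₁' d' c n₂)
            (kft_rhs_nonneg k b ℓ₁ ℓ₁' ℓ₂ n₁ d d' hN'0.le) hXB hX0
          refine hcs.trans (mul_le_mul_of_nonneg_right ?_
            (kft_rhs_nonneg k b ℓ₁ ℓ₁' ℓ₂ n₁ d d' hN'0.le))
          -- `[g ∣ (ℓ₁-ℓ₁') n₁] g ≤ [g ∣ ℓ₁-ℓ₁'] g`
          by_cases hdiv : ((Int.gcd (d - d') b : ℕ) : ℤ) ∣ ((ℓ₁ : ℤ) - ℓ₁') * n₁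
          · have hg : ((Int.gcd (d - d') b : ℕ) : ℤ) ∣ ((ℓ₁ : ℤ) - ℓ₁') := by
              refine Int.dvd_of_dvd_mul_left_of_gcd_one hdiv ?_
              have h1 : (Int.gcd (d - d') b) ∣ b :=
                Int.natCast_dvd_natCast.mp (Int.gcd_dvd_right (d - d') b)
              have h2 : Nat.Coprime (Int.gcd (d - d') b) n₁ :=
                Nat.Coprime.coprime_dvd_left h1 hn₁b.symm
              rw [Int.gcd_natCast_natCast]
              exact h2
            rw [if_pos hdiv, if_pos hg]
          · rw [if_neg hdiv]
            split_ifs <;> positivity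
        have hrs := kfc_rhs_sum_le k hb hL ⟨hLℓ₁, hℓ₁L⟩ ⟨hLℓ₁', hℓ₁'L⟩ ⟨hLℓ₂, hℓ₂L⟩ hd hd'
          hΔ hN' hT' I' hI'sub hI'N
        have hWeq : W ℓ₁ d ℓ₁' d' =
            (if ((Int.gcd (d - d') b : ℕ) : ℤ) ∣ ((ℓ₁ : ℤ) - ℓ₁') then (Int.gcd (d - d') b : ℝ)
              else 0) * (if ℓ₁ = ℓ₁' then (ℓ₁ : ℝ) else 1) := by
          simp only [hW, if_neg hpp]
        have hite0 : 0 ≤ (if ((Int.gcd (d - d') b : ℕ) : ℤ) ∣ ((ℓ₁ : ℤ) - ℓ₁') then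
            (Int.gcd (d - d') b : ℝ) else 0) := by split_ifs <;> positivity
        calc ∑ n₁ ∈ I', ∑ c ∈ Cb, ‖∑ n₂ ∈ T₂, PT ℓ₂ n₁ ℓ₁ d ℓ₁' d' c n₂‖
            ≤ ∑ n₁ ∈ I', (if ((Int.gcd (d - d') b : ℕ) : ℤ) ∣ ((ℓ₁ : ℤ) - ℓ₁') then
                (Int.gcd (d - d') b : ℝ) else 0) * RHS ℓ₂ n₁ ℓ₁ d ℓ₁' d' :=
              Finset.sum_le_sum hper
          _ = (if ((Int.gcd (d - d') b : ℕ) : ℤ) ∣ ((ℓ₁ : ℤ) - ℓ₁') then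
                (Int.gcd (d - d') b : ℝ) else 0) * ∑ n₁ ∈ I', RHS ℓ₂ n₁ ℓ₁ d ℓ₁' d' := by
              rw [Finset.mul_sum]
          _ ≤ (if ((Int.gcd (d - d') b : ℕ) : ℤ) ∣ ((ℓ₁ : ℤ) - ℓ₁') then
                (Int.gcd (d - d') b : ℝ) else 0) *
                ((if ℓ₁ = ℓ₁' then (ℓ₁ : ℝ) else 1) * Bsum) := by
              refine mul_le_mul_of_nonneg_left ?_ hite0
              rw [hBsum]
              exact hrs
          _ = W ℓ₁ d ℓ₁' d' * Bsum := by rw [hWeq]; ring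
      · -- the degenerate case: every term vanishes
        have hzero : ∀ n₁ ∈ I', ∀ c ∈ Cb, ∑ n₂ ∈ T₂, PT ℓ₂ n₁ ℓ₁ d ℓ₁' d' c n₂ = 0 := by
          intro n₁ _ c _
          refine Finset.sum_eq_zero fun n₂ _ => ?_
          simp only [hPT]
          by_cases h1 : NDC ℓ₂ n₁ ℓ₁ n₂ ∧ NDC ℓ₂ n₁ ℓ₁' n₂
          · rw [if_pos h1]
            by_cases h2 : A ℓ₂ n₁ ℓ₁ d c n₂ ∧ A ℓ₂ n₁ ℓ₁' d' c n₂
            · exact absurd ⟨h1.1.1, kft_not_dvd hp₁ hp₂ h1.1 h2.1.1⟩ hG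
            · rw [if_neg h2]
          · rw [if_neg h1]
        calc ∑ n₁ ∈ I', ∑ c ∈ Cb, ‖∑ n₂ ∈ T₂, PT ℓ₂ n₁ ℓ₁ d ℓ₁' d' c n₂‖ = 0 := by
              refine Finset.sum_eq_zero fun n₁ hn₁ => Finset.sum_eq_zero fun c hc => ?_
              rw [hzero n₁ hn₁ c hc, norm_zero]
          _ ≤ W ℓ₁ d ℓ₁' d' * Bsum := mul_nonneg (hW0 _ _ _ _) hBsum0
  -- Step 2: the sum of `H` over all pairs
  have hHsum : ∑ ℓ₁ ∈ 𝓛, ∑ d ∈ Dset, ∑ ℓ₁' ∈ 𝓛, ∑ d' ∈ Dset, H ℓ₁ d ℓ₁' d' ≤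
      (I'.card : ℝ) * Dg * ((𝓛.card : ℝ) * (2 * D)) +
        24 * (b.divisors.card : ℝ) * (L : ℝ) ^ 2 * (D : ℝ) ^ 2 * Bsum := by
    have h1 : ∀ ℓ₁ ∈ 𝓛, ∀ d ∈ Dset, ∑ ℓ₁' ∈ 𝓛, ∑ d' ∈ Dset,
        (if (ℓ₁, d) = (ℓ₁', d') then (I'.card : ℝ) * Dg else 0) = (I'.card : ℝ) * Dg := by
      intro ℓ₁ hℓ₁ d hd
      rw [← Finset.sum_product (s := 𝓛) (t := Dset)
        (f := fun p' => if (ℓ₁, d) = p' then (I'.card : ℝ) * Dg else 0)]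
      rw [Finset.sum_ite_eq]
      rw [if_pos (Finset.mem_product.mpr ⟨hℓ₁, hd⟩)]
    have h2 : ∑ ℓ₁ ∈ 𝓛, ∑ d ∈ Dset, ∑ ℓ₁' ∈ 𝓛, ∑ d' ∈ Dset,
        (if (ℓ₁, d) = (ℓ₁', d') then (I'.card : ℝ) * Dg else 0) =
        (I'.card : ℝ) * Dg * ((𝓛.card : ℝ) * (2 * D)) := by
      rw [Finset.sum_congr rfl fun ℓ₁ hℓ₁ => Finset.sum_congr rfl fun d hd => h1 ℓ₁ hℓ₁ d hd]
      rw [Finset.sum_const, Finset.sum_const, nsmul_eq_mul, nsmul_eq_mul, hDcard]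
      ring
    have h3 := kfc_pair_weight_le hb 𝓛 h𝓛' D
    have h4 : ∑ ℓ₁ ∈ 𝓛, ∑ d ∈ Dset, ∑ ℓ₁' ∈ 𝓛, ∑ d' ∈ Dset, W ℓ₁ d ℓ₁' d' * Bsum ≤
        24 * (b.divisors.card : ℝ) * (L : ℝ) ^ 2 * (D : ℝ) ^ 2 * Bsum := by
      have : ∑ ℓ₁ ∈ 𝓛, ∑ d ∈ Dset, ∑ ℓ₁' ∈ 𝓛, ∑ d' ∈ Dset, W ℓ₁ d ℓ₁' d' * Bsum =
          (∑ ℓ₁ ∈ 𝓛, ∑ d ∈ Dset, ∑ ℓ₁' ∈ 𝓛, ∑ d' ∈ Dset, W ℓ₁ d ℓ₁' d') * Bsum := by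
        simp only [Finset.sum_mul]
      rw [this]
      exact mul_le_mul_of_nonneg_right h3 hBsum0
    calc ∑ ℓ₁ ∈ 𝓛, ∑ d ∈ Dset, ∑ ℓ₁' ∈ 𝓛, ∑ d' ∈ Dset, H ℓ₁ d ℓ₁' d'
        = ∑ ℓ₁ ∈ 𝓛, ∑ d ∈ Dset, ∑ ℓ₁' ∈ 𝓛, ∑ d' ∈ Dset,
            (if (ℓ₁, d) = (ℓ₁', d') then (I'.card : ℝ) * Dg else 0) +
          ∑ ℓ₁ ∈ 𝓛, ∑ d ∈ Dset, ∑ ℓ₁' ∈ 𝓛, ∑ d' ∈ Dset, W ℓ₁ d ℓ₁' d' * Bsum := by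
          simp only [hH, Finset.sum_add_distrib]
      _ ≤ _ := by rw [h2]; exact add_le_add le_rfl h4
  -- Step 3: for fixed `ℓ₂`, the `(n₁, n₂, c)`-sum
  have hℓ₂_bd : ∀ ℓ₂ ∈ 𝓛, ∑ n₁ ∈ I', ∑ n₂ ∈ I', ∑ c ∈ Cb, ‖V ℓ₂ n₁ n₂ c‖ ^ 2 ≤
      (I'.card : ℝ) * Dg * ((𝓛.card : ℝ) * (2 * D)) +
        24 * (b.divisors.card : ℝ) * (L : ℝ) ^ 2 * (D : ℝ) ^ 2 * Bsum := by
    intro ℓ₂ hℓ₂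
    calc ∑ n₁ ∈ I', ∑ n₂ ∈ I', ∑ c ∈ Cb, ‖V ℓ₂ n₁ n₂ c‖ ^ 2
        ≤ ∑ n₁ ∈ I', ∑ n₂ ∈ T₂, ∑ c ∈ Cb, ‖V ℓ₂ n₁ n₂ c‖ ^ 2 := by
          refine Finset.sum_le_sum fun n₁ _ => ?_
          exact Finset.sum_le_sum_of_subset_of_nonneg hI'T₂
            (fun n₂ _ _ => Finset.sum_nonneg fun c _ => by positivity)
      _ ≤ ∑ n₁ ∈ I', ∑ ℓ₁ ∈ 𝓛, ∑ d ∈ Dset, ∑ ℓ₁' ∈ 𝓛, ∑ d' ∈ Dset, ∑ c ∈ Cb,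
            ‖∑ n₂ ∈ T₂, PT ℓ₂ n₁ ℓ₁ d ℓ₁' d' c n₂‖ := by
          refine Finset.sum_le_sum fun n₁ _ => ?_
          exact kfc_expand_sq_le 𝓛 T₂ Cb Dset (fun ℓ₁ n₂ => NDC ℓ₂ n₁ ℓ₁ n₂)
            (fun ℓ₁ d c n₂ => A ℓ₂ n₁ ℓ₁ d c n₂) (fun ℓ₁ d n₂ => E ℓ₂ n₁ ℓ₁ d n₂)
      _ = ∑ ℓ₁ ∈ 𝓛, ∑ d ∈ Dset, ∑ ℓ₁' ∈ 𝓛, ∑ d' ∈ Dset, ∑ n₁ ∈ I', ∑ c ∈ Cb,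
            ‖∑ n₂ ∈ T₂, PT ℓ₂ n₁ ℓ₁ d ℓ₁' d' c n₂‖ := by
          rw [Finset.sum_comm]
          refine Finset.sum_congr rfl fun ℓ₁ _ => ?_
          rw [Finset.sum_comm]
          refine Finset.sum_congr rfl fun d _ => ?_
          rw [Finset.sum_comm]
          refine Finset.sum_congr rfl fun ℓ₁' _ => ?_
          rw [Finset.sum_comm]
      _ ≤ ∑ ℓ₁ ∈ 𝓛, ∑ d ∈ Dset, ∑ ℓ₁' ∈ 𝓛, ∑ d' ∈ Dset, H ℓ₁ d ℓ₁' d' :=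
          Finset.sum_le_sum fun ℓ₁ hℓ₁ => Finset.sum_le_sum fun d hd =>
            Finset.sum_le_sum fun ℓ₁' hℓ₁' => Finset.sum_le_sum fun d' hd' =>
              hpair_bd ℓ₂ hℓ₂ ℓ₁ hℓ₁ d hd ℓ₁' hℓ₁' d' hd'
      _ ≤ _ := hHsum
  -- Step 4: sum over `ℓ₂`
  have hfin : ∑ ℓ₂ ∈ 𝓛, ∑ n₁ ∈ I', ∑ n₂ ∈ I', ∑ c ∈ Cb, ‖V ℓ₂ n₁ n₂ c‖ ^ 2 ≤
      (𝓛.card : ℝ) * ((⌊2 * N'⌋₊ : ℝ) * ((𝓛.card : ℝ) * (2 * D)) * Dg +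
        24 * (b.divisors.card : ℝ) * (L : ℝ) ^ 2 * (D : ℝ) ^ 2 * Bsum) := by
    calc ∑ ℓ₂ ∈ 𝓛, ∑ n₁ ∈ I', ∑ n₂ ∈ I', ∑ c ∈ Cb, ‖V ℓ₂ n₁ n₂ c‖ ^ 2
        ≤ ∑ ℓ₂ ∈ 𝓛, ((I'.card : ℝ) * Dg * ((𝓛.card : ℝ) * (2 * D)) +
            24 * (b.divisors.card : ℝ) * (L : ℝ) ^ 2 * (D : ℝ) ^ 2 * Bsum) :=
          Finset.sum_le_sum hℓ₂_bd
      _ = (𝓛.card : ℝ) * ((I'.card : ℝ) * Dg * ((𝓛.card : ℝ) * (2 * D)) +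
            24 * (b.divisors.card : ℝ) * (L : ℝ) ^ 2 * (D : ℝ) ^ 2 * Bsum) := by
          rw [Finset.sum_const, nsmul_eq_mul]
      _ ≤ _ := by
          refine mul_le_mul_of_nonneg_left (add_le_add ?_ le_rfl) (Nat.cast_nonneg _)
          have h0 : (0 : ℝ) ≤ (𝓛.card : ℝ) * (2 * D) := by positivity
          calc (I'.card : ℝ) * Dg * ((𝓛.card : ℝ) * (2 * D))
              ≤ (⌊2 * N'⌋₊ : ℝ) * Dg * ((𝓛.card : ℝ) * (2 * D)) :=
                mul_le_mul_of_nonneg_right (mul_le_mul_of_nonneg_right hI'card hDg0) h0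
            _ = (⌊2 * N'⌋₊ : ℝ) * ((𝓛.card : ℝ) * (2 * D)) * Dg := by ring
  rw [hBsum, hDg] at hfin
  exact hfin

/-! ### The bound for `𝒮` -/

/-- **The coprime nondegenerate off-diagonal sum `𝒮`** (B–C §4.1.5 (ees) with `A = 1`, in our
explicit form): combining `kfs_S_norm_le` (Cauchy–Schwarz) with `kft_T_le`,

  `‖𝒮‖ ≤ ‖γ‖² (#𝓛 φ(b))^{1/2} · (T-bound)^{1/2}`,

where `T-bound` is the right-hand side of `kft_T_le`. [cite: BettinChandee2018, §4.1.5] -/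
theorem kft_S_le (k : ℤ) {b : ℕ} (hb : 0 < b) (γ : ℕ → ℂ) {N' : ℝ} (hN' : 1 / 2 ≤ N')
    (hγ : ∀ n, γ n ≠ 0 → N' < n ∧ n.Coprime b ∧ Int.gcd k n = 1)
    {L : ℕ} (hL : 1 ≤ L) (𝓛 : Finset ℕ)
    (h𝓛 : ∀ ℓ ∈ 𝓛, ℓ.Prime ∧ L < ℓ ∧ ℓ ≤ 2 * L ∧ ℓ.Coprime b ∧ Int.gcd k ℓ = 1)
    {M₁ M₂ : ℕ} (hM : M₁ ≤ M₂) (D : ℕ) (hD : 4 * (L : ℝ) * N' ≤ (D : ℝ) * (M₁ + 1)) {T' : ℝ}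
    (hT' : ∀ w : ℕ, 1 ≤ w → (w : ℝ) ≤ 16 * (L : ℝ) ^ 2 * (N' + D) → (w.divisors.card : ℝ) ≤ T') :
    ‖∑ m ∈ (Ioc M₁ M₂).filter (fun m => m.Coprime b),
        ∑ ℓ₁ ∈ 𝓛, ∑ n₁ ∈ Icc 1 ⌊2 * N'⌋₊, ∑ ℓ₂ ∈ 𝓛, ∑ n₂ ∈ Icc 1 ⌊2 * N'⌋₊,
          (if (ℓ₁ ≠ ℓ₂ ∧ n₁.Coprime n₂ ∧ (n₁ * n₂).Coprime (ℓ₁ * ℓ₂)) then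
            (if (ℓ₂ * n₂).Coprime m ∧ ((ℓ₁ * n₁ : ℕ) : ZMod m) = ((ℓ₂ * n₂ : ℕ) : ZMod m) then
              γ n₁ * kfPhase k (b * n₁) m * (starRingEnd ℂ) (γ n₂ * kfPhase k (b * n₂) m)
            else 0)
          else 0)‖ ≤
      (∑ n ∈ Icc 1 ⌊2 * N'⌋₊, ‖γ n‖ ^ 2) *
        Real.sqrt (𝓛.card * ((Finset.range b).filter (fun c => c.Coprime b)).card) *
        Real.sqrt ((𝓛.card : ℝ) *
          ((⌊2 * N'⌋₊ : ℝ) * ((𝓛.card : ℝ) * (2 * D)) * (((M₂ : ℝ) - M₁) / L + 1) +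
            24 * (b.divisors.card : ℝ) * (L : ℝ) ^ 2 * (D : ℝ) ^ 2 *
              (4 * T' * N' * (1 + 8 * Real.pi * |(k : ℝ)| * D / ((b : ℝ) * L * N' ^ 2)) *
                ((N' + 4) / N' + T' * L * Real.sqrt (8 * N') *
                  (1 + Real.log (8 * (L : ℝ) ^ 2 * N')))))) := by
  have he : ∀ (k : ℤ) (q m : ℕ), kfPhase k q m = Complex.exp (2 * Real.pi * Complex.I *
      ((k : ℂ) * ((((m : ZMod q)⁻¹).val : ℕ) : ℂ) / (q : ℂ))) := fun _ _ _ => rfl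
  have h1 := kfs_S_norm_le kfPhase he k hb γ (fun n hn => (hγ n hn).2.1) 𝓛
    (fun ℓ hℓ => ⟨(h𝓛 ℓ hℓ).1, (h𝓛 ℓ hℓ).2.1, (h𝓛 ℓ hℓ).2.2.1⟩) hN' M₁ M₂ D hD
  have h2 := kft_T_le k hb γ hN' hγ hL 𝓛 h𝓛 hM D hT'
  refine h1.trans (mul_le_mul_of_nonneg_left (Real.sqrt_le_sqrt h2) ?_)
  exact mul_nonneg (Finset.sum_nonneg fun n _ => by positivity) (Real.sqrt_nonneg _)

end Literature.NumberTheory.LFunctions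

end
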